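import Mathlib.Geometry.Manifold.PoincareConjecture
import Literature.Topology.FourManifolds.Trisections
import HarnessLib

/-!
# Small trisections are standard (Meier–Zupan; Meier–Schirmer–Zupan) — homotopy-sphere corollaries

Named facts (D-0014) requested by route SmoothPoincare4/GroupTrisection (`wi-03929`), over
`Literature.Topology.FourManifolds.IsTrisection` (unbalanced `(g; k₀, k₁, k₂)`-trisections, `Trisections.lean`).

Sources (arXiv TeX checked, `tmp/mz_*`):

* J. Meier, A. Zupan, *Genus two trisections are standard*, Geom. Topol. 21 (2017); arXiv:1410.8133,
  main theorem (Thm. 1.3 there = Thm. 1.2 of the journal): a closed 4-manifold with a (balanced)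
  genus-two trisection is `S² × S²` or a connected sum, with two summands, of `S¹ × S³`, `ℂP²`,
  `ℂP²‾`; genus `0` gives `S⁴` (Laudenbach–Poénaru) and genus `1` gives `ℂP²`, `ℂP²‾`, `S¹ × S³`
  (Gay–Kirby), as recalled in §1 there.
* J. Meier, T. Schirmer, A. Zupan, *Classification of trisections and the generalized property R
  conjecture*, Proc. AMS 144 (2016); arXiv:1507.06561, Thm. 1.1 (`thm:class`): if `X` admits a
  `(g; k₁, k₂, k₃)`-trisection with `k₁ ≥ g - 1` then, with `k' = max(k₂, k₃)`, `X` is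
  diffeomorphic to `#^{k'}(S¹ × S³)` or to its connected sum with `ℂP²` or `ℂP²‾`.

The route needs these only for HOMOTOPY 4-SPHERES, where every manifold in the two lists other than
`S⁴ = #⁰(S¹ × S³)` is excluded by `H₁ = H₂ = 0`. We therefore record the two corollaries with the
conclusion "diffeomorphic to `S⁴`" (weaker than, and implied by, the printed classifications; the
full lists would need the tree's `ℂP²`/connected-sum vocabulary matched to `IsTrisection`, not
attempted here):

* `msz_standard_homotopySphere` — a closed connected oriented smooth homotopy 4-sphere with a
  `(g; k)`-trisection having SOME `kᵢ ≥ g - 1` is diffeomorphic to `S⁴` [MSZ Thm. 1.1, sectors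
  relabelled by `IsTrisection.comp_perm`];
* `mz_genus_le_two_homotopySphere` — a closed connected oriented smooth homotopy 4-sphere with a
  trisection of genus `≤ 2` is diffeomorphic to `S⁴` [MZ main theorem for the balanced `(2; 0,0,0)`
  case — whose list contains no homotopy sphere — and MSZ Thm. 1.1 for all other `g ≤ 2` cases,
  since then some `kᵢ ≥ 1 ≥ g - 1` or `g ≤ 1`].

Consequently the genus-`3` homotopy 4-spheres not covered are exactly the `(3; 1, 1, 1)` ones
(`kᵢ ≤ 1 < 2 = g - 1`), as the request notes.

## References

* [MeierZupan2017] J. Meier, A. Zupan, Geom. Topol. 21 (2017) 1583–1630, Thm. 1.2.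
* [MeierSchirmerZupan2016] J. Meier, T. Schirmer, A. Zupan, Proc. Amer. Math. Soc. 144 (2016)
  4983–4997, Thm. 1.1.
* [GayKirby2016] D. Gay, R. Kirby, Geom. Topol. 20 (2016), §1 (genus `≤ 1`).
-/

noncomputable section

open scoped Manifold ContDiff
open Set ContinuousMap

namespace Literature.Topology.FourManifolds

universe u

/-- The round 4-sphere `S⁴ ⊆ ℝ⁵` with Mathlib's smooth structure. [folklore] -/
local notation "𝕊⁴" => (Metric.sphere (0 : EuclideanSpace ℝ (Fin 5)) 1)

/-- **Meier–Schirmer–Zupan (2016), Thm. 1.1 — homotopy-sphere corollary.** Let `X` be a closed,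
connected, oriented smooth 4-manifold with a `(g; k₀, k₁, k₂)`-trisection such that some
`kᵢ ≥ g - 1`. If `X` is homotopy equivalent to `S⁴` then `X` is diffeomorphic to `S⁴`. (MSZ: such
`X` is `#^{k'}(S¹ × S³)` possibly summed with `±ℂP²`; a homotopy sphere among these is `S⁴`.)
[cite: MeierSchirmerZupan2016, Thm. 1.1] -/
def msz_standard_homotopySphere : Prop :=
  ∀ (X : Type u) [TopologicalSpace X] [T2Space X] [SecondCountableTopology X]
    [ChartedSpace (EuclideanSpace ℝ (Fin 4)) X] [IsManifold (𝓡 4) ∞ X] [CompactSpace X]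
    [ConnectedSpace X] (_ : SmoothOrientation (𝓡 4) X) (g : ℕ) (k : Fin 3 → ℕ)
    (S : Fin 3 → Set X), IsTrisection X g k S → (∃ i, g ≤ k i + 1) →
      X ≃ₕ 𝕊⁴ → Nonempty (X ≃ₘ⟮𝓡 4, 𝓡 4⟯ 𝕊⁴)

/-- **Meier–Zupan (2017) with Meier–Schirmer–Zupan (2016) — genus `≤ 2` homotopy 4-spheres are
standard.** Let `X` be a closed, connected, oriented smooth 4-manifold admitting a trisection of
genus `g ≤ 2` (any `(g; k₀, k₁, k₂)`). If `X` is homotopy equivalent to `S⁴` then `X` is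
diffeomorphic to `S⁴`. (Genus `≤ 1`: `S⁴`, `ℂP²`, `ℂP²‾`, `S¹ × S³`; balanced genus `2`: MZ's list,
containing no homotopy sphere; unbalanced genus `2`: MSZ Thm. 1.1.)
[cite: MeierZupan2017, Thm. 1.2] [cite: MeierSchirmerZupan2016, Thm. 1.1] -/
def mz_genus_le_two_homotopySphere : Prop :=
  ∀ (X : Type u) [TopologicalSpace X] [T2Space X] [SecondCountableTopology X]
    [ChartedSpace (EuclideanSpace ℝ (Fin 4)) X] [IsManifold (𝓡 4) ∞ X] [CompactSpace X]
    [ConnectedSpace X] (_ : SmoothOrientation (𝓡 4) X) (g : ℕ) (k : Fin 3 → ℕ)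
    (S : Fin 3 → Set X), IsTrisection X g k S → g ≤ 2 →
      X ≃ₕ 𝕊⁴ → Nonempty (X ≃ₘ⟮𝓡 4, 𝓡 4⟯ 𝕊⁴)

/-- From MSZ alone: every trisected homotopy 4-sphere of genus `≤ 1` is `S⁴` (`kᵢ ≥ 0 ≥ g - 1`).
[folklore] -/
theorem msz_standard_homotopySphere.genus_le_one (h : msz_standard_homotopySphere.{u})
    (X : Type u) [TopologicalSpace X] [T2Space X] [SecondCountableTopology X]
    [ChartedSpace (EuclideanSpace ℝ (Fin 4)) X] [IsManifold (𝓡 4) ∞ X] [CompactSpace X]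
    [ConnectedSpace X] (o : SmoothOrientation (𝓡 4) X) {g : ℕ} {k : Fin 3 → ℕ}
    {S : Fin 3 → Set X} (hS : IsTrisection X g k S) (hg : g ≤ 1) (e : X ≃ₕ 𝕊⁴) :
    Nonempty (X ≃ₘ⟮𝓡 4, 𝓡 4⟯ 𝕊⁴) :=
  h X o g k S hS ⟨0, by omega⟩ e

/-- From MSZ alone: a trisected homotopy 4-sphere of genus `≤ 2` with some `kᵢ ≥ 1` is `S⁴`; hence
under both facts the only genus-`≤ 3` trisections of homotopy spheres left are `(2; 0,0,0)`
(handled by `mz_genus_le_two_homotopySphere`) and `(3; k)` with all `kᵢ ≤ 1`. [folklore] -/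
theorem msz_standard_homotopySphere.genus_two (h : msz_standard_homotopySphere.{u})
    (X : Type u) [TopologicalSpace X] [T2Space X] [SecondCountableTopology X]
    [ChartedSpace (EuclideanSpace ℝ (Fin 4)) X] [IsManifold (𝓡 4) ∞ X] [CompactSpace X]
    [ConnectedSpace X] (o : SmoothOrientation (𝓡 4) X) {k : Fin 3 → ℕ}
    {S : Fin 3 → Set X} (hS : IsTrisection X 2 k S) {i : Fin 3} (hi : 1 ≤ k i) (e : X ≃ₕ 𝕊⁴) :
    Nonempty (X ≃ₘ⟮𝓡 4, 𝓡 4⟯ 𝕊⁴) :=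
  h X o 2 k S hS ⟨i, by omega⟩ e

end Literature.Topology.FourManifolds

end
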